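import Literature.Computability.Cryptography.LWEProductLaws
import Literature.Probability.Distributions.ProductLawEvents
import HarnessLib

/-!
# Reindexing, splitting, currying and marginalising finite product laws; uniform laws on function types

Topic `Computability/Cryptography` (LWE toolkit), grouping namespace `LWE`, sequel of
`LWEProductLaws.lean` (`iidPMF` splitting) and `Probability/Distributions/FiniteProductLaws.lean`
(`piLaw P`, the law of an independent family over a finite index type). Generic, proved material (no
named fact), written for the machine bridge of the Micciancio–Peikert reduction
(`LWEPrimePower*.lean`, towards `blprs_gapSVP_sqrt_dim_to_lwe_classical`, **pqc.S21**): the machine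
reads ONE flat tuple of input samples and ONE flat coin string, and cuts them into the structured,
independent pieces the phase laws of the analysis speak about; these lemmas carry the flat product
laws to the structured ones.

* `piLaw_map_restrict` — restricting an independent family along an injection `A ↪ ι` gives the
  independent family of the selected marginals (the unselected coordinates integrate out);
  `piLaw_map_comp_equiv` (reindexing along an equivalence), `piLaw_map_eval` (one marginal).
* `piLaw_map_sumSplit` — over `A ⊕ B` the family splits into two INDEPENDENT families;
  `piLaw_map_curry` — over `A × B` it curries into a family of families.
* `piLaw_const_eq_iidPMF` — the constant family over `Fin n` is `iidPMF`.
* `uniformOfFintype_map_equiv`, `uniformOfFintype_arrow_eq_piLaw` — uniform laws transport along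
  equivalences, and the uniform law on `A → β` is the independent family of uniform coordinates (so a
  uniform coin string cut into disjoint slices gives independent uniform slices).

## References

* O. Regev, *On lattices, learning with errors, random linear codes, and cryptography*, J. ACM 56
  (2009), §2 (independent samples). [RegevLWE2009]
* S. Arora, B. Barak, *Computational Complexity: A Modern Approach*, CUP 2009, Def. 7.1 (the random
  string of a probabilistic machine). [AroraBarak2009]
-/

noncomputable section

open scoped ENNReal

namespace Literature.Computability.Cryptography

namespace LWE

open Literature.Probability.Distributions

section PiMaps

variable {ι A B β : Type} [Fintype ι] [DecidableEq ι] [Fintype A] [DecidableEq A] [Fintype B] [DecidableEq B]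
  [Fintype β]

/-- **Restricting an independent family along an injection** gives the independent family of the
selected marginals. [folklore] -/
theorem piLaw_map_restrict (emb : A ↪ ι) (P : ι → PMF β) :
    (piLaw P).map (fun f a => f (emb a)) = piLaw fun a => P (emb a) := by
  classical
  ext g
  -- the fibre of `g` is a box
  let S : ι → Set β := fun i => if h : ∃ a, emb a = i then {g h.choose} else Set.univ
  have hfib : (fun f : ι → β => fun a => f (emb a)) ⁻¹' {g} = {f | ∀ i, f i ∈ S i} := by
    ext f
    simp only [Set.mem_preimage, Set.mem_singleton_iff, Set.mem_setOf_eq]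
    constructor
    · rintro hfg i
      by_cases h : ∃ a, emb a = i
      · simp only [S, dif_pos h, Set.mem_singleton_iff]
        have ha := h.choose_spec
        have e2 : f (emb h.choose) = g h.choose := congrFun hfg h.choose
        rw [← e2, ha]
      · simp [S, dif_neg h]
    · intro hf
      funext a
      have h : ∃ a', emb a' = emb a := ⟨a, rfl⟩
      have := hf (emb a)
      simp only [S, dif_pos h, Set.mem_singleton_iff] at this
      rw [this, emb.injective h.choose_spec]
  rw [← PMF.toOuterMeasure_apply_singleton, PMF.toOuterMeasure_map_apply, hfib, piLaw_toOuterMeasure_forall_mem,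
    piLaw_apply]
  -- coordinates outside the range contribute `1`
  have hsplit : ∏ i, (P i).toOuterMeasure (S i) =
      ∏ i ∈ Finset.univ.map emb, (P i).toOuterMeasure (S i) := by
    refine (Finset.prod_subset (Finset.subset_univ _) fun i _ hi => ?_).symm
    have h : ¬ ∃ a, emb a = i := by
      rintro ⟨a, rfl⟩
      exact hi (Finset.mem_map_of_mem _ (Finset.mem_univ a))
    simp only [S, dif_neg h]
    exact (PMF.toOuterMeasure_apply_eq_one_iff _ _).2 (Set.subset_univ _)
  rw [hsplit, Finset.prod_map]
  refine Finset.prod_congr rfl fun a _ => ?_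
  have h : ∃ a', emb a' = emb a := ⟨a, rfl⟩
  simp only [S, dif_pos h]
  rw [PMF.toOuterMeasure_apply_singleton, emb.injective h.choose_spec]

/-- **Reindexing an independent family along an equivalence.** [folklore] -/
theorem piLaw_map_comp_equiv (e : A ≃ ι) (P : ι → PMF β) :
    (piLaw P).map (fun f a => f (e a)) = piLaw fun a => P (e a) :=
  piLaw_map_restrict e.toEmbedding P

/-- **One marginal of an independent family.** [folklore] -/
theorem piLaw_map_eval (P : ι → PMF β) (j : ι) : (piLaw P).map (fun f => f j) = P j := by
  ext x
  rw [← PMF.toOuterMeasure_apply_singleton, PMF.toOuterMeasure_map_apply,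
    show (fun f : ι → β => f j) ⁻¹' {x} = {f | f j ∈ ({x} : Set β)} from rfl, piLaw_toOuterMeasure_eval_mem,
    PMF.toOuterMeasure_apply_singleton]

/-- **Over a sum of index types the family splits into two independent families.** [folklore] -/
theorem piLaw_map_sumSplit (P : A ⊕ B → PMF β) :
    (piLaw P).map (fun f => ((fun a => f (Sum.inl a)), (fun b => f (Sum.inr b)))) =
      prodLaw (piLaw fun a => P (Sum.inl a)) (piLaw fun b => P (Sum.inr b)) := by
  have he : (fun f : A ⊕ B → β => ((fun a => f (Sum.inl a)), (fun b => f (Sum.inr b)))) =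
      (Equiv.sumArrowEquivProdArrow A B β) := by
    funext f
    rfl
  rw [he]
  ext ⟨g₁, g₂⟩
  rw [pmf_map_equiv_apply, prodLaw_apply, piLaw_apply, piLaw_apply, piLaw_apply, Fintype.prod_sum_type]
  rfl

/-- **Over a product of index types the family curries into a family of families.** [folklore] -/
theorem piLaw_map_curry (P : A × B → PMF β) :
    (piLaw P).map (fun f a b => f (a, b)) = piLaw fun a => piLaw fun b => P (a, b) := by
  have he : (fun (f : A × B → β) (a : A) (b : B) => f (a, b)) = (Equiv.curry A B β) := by
    funext f
    rfl
  rw [he]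
  ext g
  rw [pmf_map_equiv_apply, piLaw_apply, piLaw_apply, Fintype.prod_prod_type]
  simp only [piLaw_apply]
  rfl

/-- **The constant family over `Fin n` is the iid law.** [folklore] -/
theorem piLaw_const_eq_iidPMF (p : PMF β) (n : ℕ) : piLaw (fun _ : Fin n => p) = iidPMF p n := by
  ext v
  rw [piLaw_apply, iidPMF_apply']

end PiMaps

/-! ### Uniform laws on function types -/

section Uniform

variable {α γ : Type} [Fintype α] [Fintype γ] [Nonempty α] [Nonempty γ]

/-- **A uniform law transports along an equivalence.** [folklore] -/
theorem uniformOfFintype_map_equiv (e : α ≃ γ) : (PMF.uniformOfFintype α).map e = PMF.uniformOfFintype γ := by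
  ext c
  rw [pmf_map_equiv_apply, PMF.uniformOfFintype_apply, PMF.uniformOfFintype_apply, Fintype.card_congr e]

variable {A β : Type} [Fintype A] [DecidableEq A] [Fintype β] [Nonempty β]

/-- **The uniform law on `A → β` is the independent family of uniform coordinates.** [folklore] -/
theorem uniformOfFintype_arrow_eq_piLaw :
    PMF.uniformOfFintype (A → β) = piLaw fun _ : A => PMF.uniformOfFintype β := by
  ext f
  rw [PMF.uniformOfFintype_apply, piLaw_apply]
  simp only [PMF.uniformOfFintype_apply, Finset.prod_const, Finset.card_univ, Fintype.card_fun]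
  rw [Nat.cast_pow, ENNReal.inv_pow]

end Uniform

end LWE

end Literature.Computability.Cryptography

end
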